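import Summits.AtomisticToContinuum.FouriersLaw.Theorems.BondHeatUncertaintyLinearResponseFTURBondHeatVarianceContinuityHelper4
import HarnessLib

/-!
# Crux `ExtensiveSnapshotIrreversibility` (stmt-AtomisticToContinuum-9121), line `clausius-budget-sound-window`:
sub-goal `ness_tendsto_gibbsMeasure` of stub S1r' `stub_oddLogDensityRegularity`, clause (R0)

The registered sub-goal `ness_tendsto_gibbsMeasure` of the lead's checked skeleton (v8) of the line:
**weak continuity of the two-temperature NESS family at `δ = 0`, with the limit identified as the Gibbs
state.** For the pinned anharmonic chain `P = pinnedChain ω₂ lam β γ` (all parameters positive), under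
weak-NESS uniqueness (U) and along a steady-state family `μ`, for `T > 0`, `N ≥ 2` and every bounded
continuous observable `F`,
`∫ F dμ_{N,T+δ/2,T-δ/2} → ∫ F dμ_T` as `δ → 0`, `δ ≠ 0`, where `μ_T = P.gibbsMeasure N T`.

Proof: this is the tree's weak continuity of the NESS family at `δ = 0`
(`LinearResponseFTUR.ness_tendsto_integral`, helper 4 of stub K6b of crux `LinearResponseFTUR`:
uniform exponential moments ⇒ tightness ⇒ Prokhorov; every subsequential weak limit solves the weak
stationary Fokker–Planck equation at `(T, T)` because the generator is affine in the bath temperatures,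
has integrable bond currents by Fatou, hence is `μ_{N,T,T}` by (U)), whose limit `μ_{N,T,T}` is the Gibbs
measure at `T` by (U) and `pinnedChain_isSteadyState_gibbsMeasure`
(`BondHeatUncertainty.ness_eq_gibbsMeasure`). No new definitions, no new analysis.
-/

noncomputable section

namespace Summit.AtomisticToContinuum.FouriersLaw.Theorems.ExtensiveSnapshotIrreversibility.ClausiusBudget

open MeasureTheory Filter Topology
open scoped ENNReal NNReal
open Literature.MathematicalPhysics.KineticTheory.HeatConduction

/-- **Weak continuity of the NESS family at `δ = 0`, limit = Gibbs state** (registered sub-goal of stub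
S1r' `stub_oddLogDensityRegularity`, clause (R0), line `clausius-budget-sound-window`). For the pinned
chain (all parameters `> 0`), under weak-NESS uniqueness and along a steady-state family `μ`, for `T > 0`,
`N ≥ 2` and every bounded continuous `F`:
`∫ F dμ_{N,T+δ/2,T-δ/2} → ∫ F d(gibbsMeasure N T)` as `δ → 0`, `δ ≠ 0`. The tree's
`LinearResponseFTUR.ness_tendsto_integral` (tightness from uniform exponential moments, Prokhorov,
closedness of the weak Fokker–Planck class, uniqueness at `(T, T)`) gives the limit `μ N T T`, which is
the Gibbs measure by `BondHeatUncertainty.ness_eq_gibbsMeasure`. [folklore] -/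
theorem ness_tendsto_gibbsMeasure :
    ∀ ω₂ lam β γ : ℝ, 0 < ω₂ → 0 < lam → 0 < β → 0 < γ →
      (∀ (N : ℕ) (T_L T_R : ℝ), 0 < T_L → 0 < T_R → ∀ μ ν : Measure (PhaseSpace N),
        (pinnedChain ω₂ lam β γ).IsSteadyState N T_L T_R μ →
        (pinnedChain ω₂ lam β γ).IsSteadyState N T_L T_R ν → μ = ν) →
      ∀ μ : (N : ℕ) → ℝ → ℝ → Measure (PhaseSpace N),
        (∀ (N : ℕ) (T_L T_R : ℝ), 0 < T_L → 0 < T_R →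
          (pinnedChain ω₂ lam β γ).IsSteadyState N T_L T_R (μ N T_L T_R)) →
        ∀ T : ℝ, 0 < T → ∀ N : ℕ, 2 ≤ N →
          ∀ F : PhaseSpace N → ℝ, Continuous F → (∃ B : ℝ, ∀ x, |F x| ≤ B) →
            Tendsto (fun δ : ℝ => ∫ x, F x ∂(μ N (T + δ / 2) (T - δ / 2))) (𝓝[≠] (0 : ℝ))
              (𝓝 (∫ x, F x ∂((pinnedChain ω₂ lam β γ).gibbsMeasure N T))) := by
  intro ω₂ lam β γ hω hl hβ hγ huniq μ hμ T hT N hN F hF hFB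
  obtain ⟨B, hB⟩ := hFB
  rw [← Summit.AtomisticToContinuum.FouriersLaw.Theorems.BondHeatUncertainty.ness_eq_gibbsMeasure
    hω hl hβ huniq μ hμ N hT]
  exact Summit.AtomisticToContinuum.FouriersLaw.Theorems.LinearResponseFTUR.ness_tendsto_integral
    ω₂ lam β γ hω hl hβ hγ huniq μ hμ T hT N hN F hF B hB

end Summit.AtomisticToContinuum.FouriersLaw.Theorems.ExtensiveSnapshotIrreversibility.ClausiusBudget

end
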